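/-
Copyright: harness tree, Literature layer (sorry-free). b2b-lace CARVER gen 44 (what-if / input-certification
support; d-generic, number-free).  ROW TRUNCATION OF A TWISTED SEED COSTS PLAIN SEEDS.
-/
import Literature.Probability.FitznerVanDerHofstad2017.SrwTwistBesselRow
import Literature.Probability.FitznerVanDerHofstad2017.SrwTwistRowOrderBall
import Literature.Probability.FitznerVanDerHofstad2017.SrwIntegralBesselU
import Literature.Probability.LatticeModels.GinibreBesselBounds
import Literature.Probability.LatticeModels.LatticePotentialKernelBounds
import Mathlib.Analysis.SpecialFunctions.Integrals.Basic
import Mathlib.MeasureTheory.Integral.IntegralEqImproper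
import Mathlib.MeasureTheory.Integral.Prod
import HarnessLib

/-!
# Row truncation of the twisted axis seed: the error is an explicit combination of plain seeds

For the twisted one-coordinate seed `srwTwist d (n+1) 1 (m e_i) β`
(`SrwTrigMajorant.srwTwist`; in Schwinger–Bessel form
`(n!)⁻¹ (∫₀^∞ τⁿ e^{-τ} Re B_m(τ/d, β/d)^d dτ)/(2π)^d`, `SrwTwistBesselRow`), replace the transform
`B_m(v,y) = Σ_{j≥0} ε_j I_{jm}(v)·2π iʲ J_j(y)` by its ROW TRUNCATION
`P_J(v,y) = Σ_{j≤J} ε_j I_{jm}(v)·2π iʲ J_j(y)`.  THE COST IS A FINITE, EXPLICIT, NONNEGATIVE COMBINATION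
OF PLAIN SEEDS `I_{n+1,0}(x; d) = srwI d (n+1) 0 x` at the lattice points `x` with `k` coordinates equal to
`(J+1)M` and `d-k` zeros (`1 ≤ k ≤ d`), for ANY `M ≤ |m|`:

  `|srwTwist d (n+1) 1 (m e_i) β − (n!)⁻¹(∫₀^∞ τⁿ e^{-τ} Re P_J(τ/d, β/d)^d dτ)/(2π)^d|`
  `  ≤ Σ_{k=1}^{d} C(d,k) · A_J(y)^{d-k} · (2 δ_J(y))^k · srwI d (n+1) 0 ((J+1)M,…,(J+1)M,0,…,0)`   (`k` entries `(J+1)M`)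

with `y = β/d`, `A_J(y) = Σ_{j≤J} ε_j |J_j(y)|`, `δ_J(y) = Σ_{j>J} |J_j(y)|`
(`abs_srwTwist_sub_rowTrunc_le_sum_srwI`, perturbation anchored at `P_J`), AND the UNIT-ANCHORED form
with `A_J` replaced by `1` (`abs_srwTwist_sub_rowTrunc_le_sum_srwI_unit`, anchored at `B_m` itself via
`‖B_m(v,y)‖ ≤ 2π I_0(v)`, `norm_axisTransform_μI_le`) — use the unit form for `J ≥ 1` (by value
`A_J ≈ 1.5–2.9` for `y ≤ 3`) and the `A_0 = |J_0(y)| ≤ 1` form for `J = 0`; coarsened one-seed versions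
`((A_J+2δ_J)^d − A_J^d)·srwI(… (J+1)M e_0 …)` / `((1+2δ_J)^d − 1)·srwI(…)`
(`abs_srwTwist_sub_rowTrunc_le_incr_mul_srwI[_unit]`, via the seed monotonicity
`srwI_twoLevel_le_axis`).  COEFFICIENT PERTURBATION (`abs_rowObj_sub_rowObj_le_incr_mul_srwI_zero`):
for ANY two coefficient vectors `c, c'` the finite-row objects differ by at most
`((α'+η)^d − α'^d)/(2π)^d · srwI d (n+1) 0 0` (`α' = Σ ε_j‖c'_j‖`, `η = Σ ε_j‖c_j − c'_j‖`) — so a kernel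
may use EXACT (complex-)rational rows `c'_j = 2π iʲ q_j` and pay `|J_j(y) − q_j|` outside, by the origin
seed.  Ingredients, all landed and d-free: the order ball `‖B_m − P_J‖ ≤ 4π I_{(J+1)m}(v) δ_J`
(`SrwTwistRowOrderBall`), `I_{(J+1)m} ≤ I_{(J+1)M} ≤ I_0` (`GinibreBesselBounds`),
`|Re(a+r)^d − Re a^d| ≤ (‖a‖+ρ)^d − ‖a‖^d = Σ_{k≥1} C(d,k)‖a‖^{d-k}ρ^k`, `‖P_J‖ ≤ 2π A_J I_0(v)`,
`‖B_m‖ ≤ 2π I_0(v)`, and `e^{-τ} I_0(τ/d)^{d-k} I_c(τ/d)^k = ∏_μ q_{τ/d}(x_μ)` with the Bessel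
`u`-representation `srwI d (n+1) 0 x = (n!)⁻¹ ∫₀^∞ τⁿ ∏_μ q_{τ/d}(x_μ) dτ` (`SrwIntegralBesselU`).

USES (what-if lane; nothing here is a certificate).  (i) `J = 0`, `M ≤ |m|`: the m-UNIFORM ROW device
`|S(β; m) − J_0(β/d)^d·(main)| ≤ …` for ALL `|m| ≥ M` at once, with a right-hand side the EXISTING plain
SEEDCERT kernel certifies (KU-SEP-SPEC §3 item 5) — no new kernel object; (ii) general `J`: the ORDER-BALL
budget of a twisted-seed kernel certificate (item 4) is a sum of `d` plain seeds, again existing-kernel work.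
Also proved here (needed, d-generic; continuity of `t ↦ q_t(m)` is the tree's
`LatticeModels.continuous_srwHeatKernel_left`): `q_t(0) ≤ (1 ∨ t)^{-1/2}`, and the
INTEGRABILITY of every seed integrand `τⁿ ∏_μ q_{τ/d}(x_μ)` on `(0,∞)` for `d ≥ 2n+3`
(`integrableOn_pow_mul_prod_srwHeatKernel`).

No statement at a specific dimension; no table; standard axioms only.

## References
* R. Fitzner, R. van der Hofstad, PTRF 169 (2017) 1041–1119, (3.34)–(3.36) p. 1071, §5.1.1 (5.2)–(5.5).
  [FitznerVanDerHofstad2016NoBLE]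
* NIST DLMF §10.32.1 (`I_0` integral), §10.35 (generating function for `I_ν`), §10.14.4, §10.37. [DLMF]
* G. N. Watson, *A Treatise on the Theory of Bessel Functions* (1944), §2.22, §3.71. [Watson1944]
-/

noncomputable section

open MeasureTheory Set Filter Real Finset
open scoped Topology Nat

namespace Literature.Probability.FitznerVanDerHofstad2017

open Literature.Barriers.CriticalPhenomena
open Literature.Barriers.CriticalPhenomena.Slade2006Prop53 (μI P)
open Literature.Probability.LatticeModels (besselI besselI_nonneg besselI_le_of_natAbs_le srwHeatKernel
  abs_srwHeatKernel_le_one integral_exp_neg_mul_one_sub_cos_le continuous_srwHeatKernel_left)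
open Literature.Analysis.FunctionSpaces (besselJ)

variable {d : ℕ}

/-! ### Continuity, decay and integrability of the seed integrands -/


/-- `q_t(0) ≤ (1 ∨ t)^{-1/2}` for `t ≥ 0` (heat-kernel decay). [cite: FitznerVanDerHofstad2016NoBLE, §5.1.1 (5.2)–(5.4)] -/
theorem srwHeatKernel_zero_le_rpow {t : ℝ} (ht : 0 ≤ t) :
    srwHeatKernel t 0 ≤ (max 1 t) ^ (-(1 / 2 : ℝ)) := by
  unfold srwHeatKernel
  have h := integral_exp_neg_mul_one_sub_cos_le ht
  simp only [Int.cast_zero, mul_zero, Real.cos_zero, one_mul]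
  rw [div_le_iff₀ (by positivity)]
  linarith

/-- `q_t(m) ≤ q_t(0)` for `t ≥ 0` (`I_m ≤ I_0`). [cite: DLMF, 10.37] -/
theorem srwHeatKernel_le_zero_index {t : ℝ} (ht : 0 ≤ t) (m : ℤ) :
    srwHeatKernel t m ≤ srwHeatKernel t 0 := by
  rw [srwHeatKernel_eq_exp_neg_mul_besselI, srwHeatKernel_eq_exp_neg_mul_besselI]
  exact mul_le_mul_of_nonneg_left (besselI_le_of_natAbs_le ht (by simp)) (Real.exp_pos _).le

/-- **Integrability of the origin seed integrand**: `τ ↦ τⁿ q_{τ/d}(0)^d` is integrable on `(0,∞)`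
for `d ≥ 2n + 3` (`q_t(0) ≤ t^{-1/2}` for `t ≥ 1`). [cite: FitznerVanDerHofstad2016NoBLE, §5.1.1 (5.2)–(5.4)] -/
theorem integrableOn_pow_mul_srwHeatKernel_zero_pow (n : ℕ) (hd : 2 * n + 3 ≤ d) :
    IntegrableOn (fun τ : ℝ => τ ^ n * srwHeatKernel (τ / d) 0 ^ d) (Ioi 0) := by
  have hd0 : (0 : ℝ) < d := by exact_mod_cast (by omega : 0 < d)
  have hmeas : AEStronglyMeasurable (fun τ : ℝ => τ ^ n * srwHeatKernel (τ / d) 0 ^ d)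
      (volume.restrict (Ioi 0)) := by
    have hc : Continuous (fun τ : ℝ => τ ^ n * srwHeatKernel (τ / d) 0 ^ d) :=
      (continuous_pow n).mul (((continuous_srwHeatKernel_left 0).comp
        (continuous_id.div_const _)).pow d)
    exact hc.aestronglyMeasurable
  have hcont : Continuous (fun τ : ℝ => τ ^ n * srwHeatKernel (τ / d) 0 ^ d) :=
    (continuous_pow n).mul (((continuous_srwHeatKernel_left 0).comp
      (continuous_id.div_const _)).pow d)
  -- near part `(0, d]`: bounded by `d^n`
  have hnear : IntegrableOn (fun τ : ℝ => τ ^ n * srwHeatKernel (τ / d) 0 ^ d) (Set.Ioc 0 d) := by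
    refine Measure.integrableOn_of_bounded (M := (d : ℝ) ^ n) measure_Ioc_lt_top.ne
      hcont.aestronglyMeasurable ?_
    · rw [ae_restrict_iff' measurableSet_Ioc]
      refine Eventually.of_forall fun τ hτ => ?_
      have hτ0 : 0 ≤ τ := hτ.1.le
      have hq0 : 0 ≤ srwHeatKernel (τ / d) 0 := srwHeatKernel_nonneg (by positivity) 0
      have hq1 : srwHeatKernel (τ / d) 0 ≤ 1 :=
        (le_abs_self _).trans (abs_srwHeatKernel_le_one (by positivity) 0)
      rw [Real.norm_eq_abs, abs_of_nonneg (by positivity)]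
      calc τ ^ n * srwHeatKernel (τ / d) 0 ^ d ≤ (d : ℝ) ^ n * 1 ^ d := by
            gcongr
            exact hτ.2
        _ = (d : ℝ) ^ n := by ring
  -- far part `(d, ∞)`: bounded by `d^{d/2} τ^{n - d/2}`
  have hfar : IntegrableOn (fun τ : ℝ => τ ^ n * srwHeatKernel (τ / d) 0 ^ d) (Ioi d) := by
    have hexp : (n : ℝ) - (d : ℝ) / 2 < -1 := by
      have : (2 * n + 3 : ℝ) ≤ d := by exact_mod_cast hd
      linarith
    have hdom : IntegrableOn (fun τ : ℝ => (d : ℝ) ^ ((d : ℝ) / 2) * τ ^ ((n : ℝ) - (d : ℝ) / 2)) (Ioi d) :=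
      (integrableOn_Ioi_rpow_of_lt hexp hd0).const_mul _
    refine hdom.mono' hcont.aestronglyMeasurable ?_
    rw [ae_restrict_iff' measurableSet_Ioi]
    refine Eventually.of_forall fun τ (hτ : (d:ℝ) < τ) => ?_
    have hτ0 : 0 < τ := hd0.trans hτ
    have hq0 : 0 ≤ srwHeatKernel (τ / d) 0 := srwHeatKernel_nonneg (by positivity) 0
    have h1 : 1 ≤ τ / d := by rw [le_div_iff₀ hd0]; linarith
    have hq : srwHeatKernel (τ / d) 0 ≤ (τ / d) ^ (-(1 / 2 : ℝ)) := by
      have := srwHeatKernel_zero_le_rpow (t := τ / d) (by positivity)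
      rwa [max_eq_right h1] at this
    rw [Real.norm_eq_abs, abs_of_nonneg (by positivity)]
    calc τ ^ n * srwHeatKernel (τ / d) 0 ^ d ≤ τ ^ n * ((τ / d) ^ (-(1 / 2 : ℝ))) ^ d := by
          gcongr
      _ = (d : ℝ) ^ ((d : ℝ) / 2) * τ ^ ((n : ℝ) - (d : ℝ) / 2) := by
          have e2 : ((τ / d) ^ (-(1 / 2 : ℝ))) ^ d = (τ / d) ^ (-((d : ℝ) / 2)) := by
            rw [← Real.rpow_natCast ((τ / d) ^ (-(1 / 2 : ℝ))) d, ← Real.rpow_mul (by positivity)]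
            congr 1; ring
          have e3 : (τ / d) ^ (-((d : ℝ) / 2)) = (d : ℝ) ^ ((d : ℝ) / 2) * τ ^ (-((d : ℝ) / 2)) := by
            rw [Real.div_rpow hτ0.le hd0.le, Real.rpow_neg hd0.le, div_inv_eq_mul, mul_comm]
          have e4 : τ ^ n * τ ^ (-((d : ℝ) / 2)) = τ ^ ((n : ℝ) - (d : ℝ) / 2) := by
            rw [← Real.rpow_natCast τ n, ← Real.rpow_add hτ0]; congr 1
          rw [e2, e3, mul_left_comm, e4]
  have hsplit : Set.Ioi (0 : ℝ) = Set.Ioc 0 (d : ℝ) ∪ Set.Ioi (d : ℝ) := (Set.Ioc_union_Ioi_eq_Ioi hd0.le).symm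
  rw [hsplit]
  exact hnear.union hfar

/-- **Integrability of every seed integrand**: `τ ↦ τⁿ ∏_μ q_{τ/d}(x_μ)` is integrable on `(0,∞)`
for `d ≥ 2n + 3` and every `x ∈ ℤ^d` (`0 ≤ q_t(m) ≤ q_t(0)`).
[cite: FitznerVanDerHofstad2016NoBLE, §5.1.1 (5.2)–(5.4)] -/
theorem integrableOn_pow_mul_prod_srwHeatKernel (n : ℕ) (hd : 2 * n + 3 ≤ d) (x : Fin d → ℤ) :
    IntegrableOn (fun τ : ℝ => τ ^ n * ∏ μ, srwHeatKernel (τ / d) (x μ)) (Ioi 0) := by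
  have hd0 : (0 : ℝ) < d := by exact_mod_cast (by omega : 0 < d)
  have hmeas : AEStronglyMeasurable (fun τ : ℝ => τ ^ n * ∏ μ, srwHeatKernel (τ / d) (x μ))
      (volume.restrict (Ioi 0)) := by
    have hc : Continuous (fun τ : ℝ => τ ^ n * ∏ μ, srwHeatKernel (τ / d) (x μ)) :=
      (continuous_pow n).mul (continuous_finsetProd _ fun μ _ =>
        (continuous_srwHeatKernel_left (x μ)).comp (continuous_id.div_const _))
    exact hc.aestronglyMeasurable
  refine (integrableOn_pow_mul_srwHeatKernel_zero_pow n hd).mono' hmeas ?_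
  rw [ae_restrict_iff' measurableSet_Ioi]
  refine Eventually.of_forall fun τ (hτ : (0:ℝ) < τ) => ?_
  have ht : 0 ≤ τ / d := by positivity
  have hq0 : ∀ m : ℤ, 0 ≤ srwHeatKernel (τ / d) m := fun m => srwHeatKernel_nonneg ht m
  rw [Real.norm_eq_abs, abs_of_nonneg (mul_nonneg (pow_nonneg hτ.le n) (Finset.prod_nonneg fun μ _ => hq0 _))]
  refine mul_le_mul_of_nonneg_left ?_ (pow_nonneg hτ.le n)
  calc ∏ μ, srwHeatKernel (τ / d) (x μ) ≤ ∏ _μ : Fin d, srwHeatKernel (τ / d) 0 :=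
        Finset.prod_le_prod (fun μ _ => hq0 _) fun μ _ => srwHeatKernel_le_zero_index ht (x μ)
    _ = srwHeatKernel (τ / d) 0 ^ d := Fin.prod_const d _


/-! ### Elementary algebra: the binomial increment and a split product over `Fin d` -/

/-- `(x+ρ)^d − x^d = Σ_{k<d} C(d,k+1) x^{d-(k+1)} ρ^{k+1}`. [folklore] -/
private theorem add_pow_sub_pow_eq_sum (x ρ : ℝ) (d : ℕ) :
    (x + ρ) ^ d - x ^ d
      = ∑ k ∈ Finset.range d, (d.choose (k + 1) : ℝ) * x ^ (d - (k + 1)) * ρ ^ (k + 1) := by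
  rw [add_comm, add_pow, Finset.sum_range_succ']
  simp only [pow_zero, Nat.sub_zero, Nat.choose_zero_right, Nat.cast_one, mul_one, one_mul,
    add_sub_cancel_right]
  exact Finset.sum_congr rfl fun k _ => by ring

/-- Monotonicity of the binomial increment: `(x+ρ)^d − x^d ≤ (α+ρ)^d − α^d` for `0 ≤ x ≤ α`, `0 ≤ ρ`.
[folklore] -/
private theorem add_pow_sub_pow_mono {x α ρ : ℝ} (hx : 0 ≤ x) (hxa : x ≤ α) (hρ : 0 ≤ ρ) (d : ℕ) :
    (x + ρ) ^ d - x ^ d ≤ (α + ρ) ^ d - α ^ d := by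
  rw [add_pow_sub_pow_eq_sum, add_pow_sub_pow_eq_sum]
  gcongr with k _

/-- `∏_{μ : Fin d} (if μ < k then a else b) = a^k b^{d-k}` for `k ≤ d`. [folklore] -/
private theorem prod_ite_val_lt {d k : ℕ} (hk : k ≤ d) (a b : ℝ) :
    ∏ μ : Fin d, (if (μ : ℕ) < k then a else b) = a ^ k * b ^ (d - k) := by
  rw [Finset.prod_ite, Finset.prod_const, Finset.prod_const]
  have hcard : (Finset.univ.filter fun μ : Fin d => (μ : ℕ) < k).card = k := by
    have heq : (Finset.univ.filter fun μ : Fin d => (μ : ℕ) < k)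
        = (Finset.range k).attachFin (fun j hj => lt_of_lt_of_le (Finset.mem_range.1 hj) hk) := by
      ext μ
      simp [Finset.mem_attachFin]
    rw [heq, Finset.card_attachFin, Finset.card_range]
  have hcard' : (Finset.univ.filter fun μ : Fin d => ¬ (μ : ℕ) < k).card = d - k := by
    have h := Finset.card_filter_add_card_filter_not (s := (Finset.univ : Finset (Fin d)))
      (fun μ : Fin d => (μ : ℕ) < k)
    rw [hcard, Finset.card_univ, Fintype.card_fin] at h
    omega
  rw [hcard, hcard']

/-! ### Norm of one row term; the truncated row is bounded by `2π A_J I_0` -/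

/-- `‖ε_j I_{jm}(v)·2π iʲ J_j(y)‖ = ε_j I_{jm}(v)·2π|J_j(y)|` (`v ≥ 0`). [cite: DLMF, 10.35.2] -/
theorem norm_besselRow_term {v : ℝ} (hv : 0 ≤ v) (y : ℝ) (m : ℤ) (j : ℕ) :
    ‖(if j = 0 then (1 : ℂ) else 2)
        * ((besselI (j * m) v : ℂ) * (2 * π * Complex.I ^ j * (besselJ j y : ℂ)))‖
      = (if j = 0 then (1 : ℝ) else 2) * (besselI (j * m) v * (2 * π * |besselJ j y|)) := by
  have hI : 0 ≤ besselI (j * m) v := besselI_nonneg hv _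
  rw [norm_mul, norm_mul, norm_mul, norm_mul, norm_pow, Complex.norm_I, one_pow, mul_one,
    Complex.norm_real, Complex.norm_real, Real.norm_eq_abs, Real.norm_eq_abs, abs_of_nonneg hI,
    norm_mul, Complex.norm_ofNat, Complex.norm_real, Real.norm_eq_abs, abs_of_pos Real.pi_pos]
  congr 1
  split_ifs <;> simp

/-- **`‖P_J(v,y)‖ ≤ 2π A_J(y) I_0(v)`** with `A_J(y) = Σ_{j≤J} ε_j|J_j(y)|` (`I_{jm} ≤ I_0`, `v ≥ 0`).
[cite: DLMF, 10.35.2, 10.37] -/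
theorem norm_besselRow_sum_range_le {v : ℝ} (hv : 0 ≤ v) (y : ℝ) (m : ℤ) (J : ℕ) :
    ‖∑ j ∈ Finset.range (J + 1), (if j = 0 then (1 : ℂ) else 2)
        * ((besselI (j * m) v : ℂ) * (2 * π * Complex.I ^ j * (besselJ j y : ℂ)))‖
      ≤ 2 * π * (∑ j ∈ Finset.range (J + 1), (if j = 0 then (1 : ℝ) else 2) * |besselJ j y|)
          * besselI 0 v := by
  refine (norm_sum_le _ _).trans ?_
  rw [Finset.mul_sum, Finset.sum_mul]
  refine Finset.sum_le_sum fun j _ => ?_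
  rw [norm_besselRow_term hv]
  have hε : (0 : ℝ) ≤ (if j = 0 then (1 : ℝ) else 2) := by split_ifs <;> norm_num
  have hI0 : besselI (j * m) v ≤ besselI 0 v := besselI_le_of_natAbs_le hv (by simp)
  have hJ : 0 ≤ |besselJ j y| := abs_nonneg _
  calc (if j = 0 then (1 : ℝ) else 2) * (besselI (j * m) v * (2 * π * |besselJ j y|))
      ≤ (if j = 0 then (1 : ℝ) else 2) * (besselI 0 v * (2 * π * |besselJ j y|)) := by
        gcongr
    _ = 2 * π * ((if j = 0 then (1 : ℝ) else 2) * |besselJ j y|) * besselI 0 v := by ring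

/-! ### The seed product at a two-level point -/

/-- `e^{-τ} I_0(τ/d)^{d-k} I_c(τ/d)^k = ∏_μ q_{τ/d}(x_μ)` for the point `x` with `k ≤ d` coordinates `c` and
`d − k` zeros. [cite: FitznerVanDerHofstad2016NoBLE, §5.1.1 (5.2)–(5.4)] -/
theorem exp_neg_mul_besselI_pow_mul_pow_eq_prod_srwHeatKernel (hd : 1 ≤ d) {k : ℕ} (hk : k ≤ d)
    (c : ℤ) (τ : ℝ) :
    Real.exp (-τ) * (besselI c (τ / d) ^ k * besselI 0 (τ / d) ^ (d - k))
      = ∏ μ : Fin d, srwHeatKernel (τ / d) (if (μ : ℕ) < k then c else 0) := by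
  have hd0 : (d : ℝ) ≠ 0 := by exact_mod_cast (by omega : d ≠ 0)
  have e1 : ∀ μ : Fin d, srwHeatKernel (τ / d) (if (μ : ℕ) < k then c else 0)
      = if (μ : ℕ) < k then srwHeatKernel (τ / d) c else srwHeatKernel (τ / d) 0 := by
    intro μ; split_ifs <;> rfl
  simp_rw [e1]
  rw [prod_ite_val_lt hk, srwHeatKernel_eq_exp_neg_mul_besselI, srwHeatKernel_eq_exp_neg_mul_besselI,
    mul_pow, mul_pow]
  have hexp : Real.exp (-(τ / d)) ^ k * Real.exp (-(τ / d)) ^ (d - k) = Real.exp (-τ) := by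
    rw [← pow_add, Nat.add_sub_cancel' hk, ← Real.exp_nat_mul]
    congr 1
    field_simp
  calc Real.exp (-τ) * (besselI c (τ / d) ^ k * besselI 0 (τ / d) ^ (d - k))
      = (Real.exp (-(τ / d)) ^ k * Real.exp (-(τ / d)) ^ (d - k))
          * (besselI c (τ / d) ^ k * besselI 0 (τ / d) ^ (d - k)) := by rw [hexp]
    _ = Real.exp (-(τ / d)) ^ k * besselI c (τ / d) ^ k
          * (Real.exp (-(τ / d)) ^ (d - k) * besselI 0 (τ / d) ^ (d - k)) := by ring

/-! ### The theorem -/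

/-- **Row truncation of the twisted axis seed costs plain seeds.** For `d ≥ 2n+3`, `m ≠ 0`, every `β`,
every truncation order `J` and every `M ≤ |m|`:
`|srwTwist d (n+1) 1 (m e_i) β − (n!)⁻¹(∫₀^∞ τⁿ e^{-τ} Re P_J(τ/d, β/d)^d dτ)/(2π)^d|`
`≤ Σ_{k<d} C(d,k+1) A_J(β/d)^{d-(k+1)} (2δ_J(β/d))^{k+1} · srwI d (n+1) 0 x_{k+1}`,
`x_k = ((J+1)M)·(e_0 + … + e_{k-1})`, `A_J(y) = Σ_{j≤J} ε_j|J_j(y)|`, `δ_J(y) = Σ_{l≥0}|J_{l+J+1}(y)|`.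
With `J = 0` this is the m-uniform row device (all `|m| ≥ M` at once); for general `J` it is the
order-ball budget of a twisted-seed certificate — in both cases the right-hand side is plain seeds.
[cite: FitznerVanDerHofstad2016NoBLE, (3.34)–(3.36) p. 1071, §5.1.1 (5.2)–(5.5); DLMF, 10.35.2, 10.14.4] -/
theorem abs_srwTwist_sub_rowTrunc_le_sum_srwI (n : ℕ) (hd : 2 * (n + 1) + 1 ≤ d) (i : Fin d)
    {m : ℤ} (hm : m ≠ 0) (β : ℝ) (J M : ℕ) (hM : M ≤ m.natAbs) :
    |srwTwist d (n + 1) (fun _ => 1) (Pi.single i m) β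
      - (n ! : ℝ)⁻¹ * (∫ τ in Ioi (0:ℝ), τ ^ n * (Real.exp (-τ) *
          ((∑ j ∈ Finset.range (J + 1), (if j = 0 then (1 : ℂ) else 2)
            * ((besselI (j * m) (τ / d) : ℂ)
              * (2 * π * Complex.I ^ j * (besselJ j (β / d) : ℂ)))) ^ d).re))
        / (2 * π) ^ d|
    ≤ ∑ k ∈ Finset.range d, (d.choose (k + 1) : ℝ)
        * (∑ j ∈ Finset.range (J + 1), (if j = 0 then (1 : ℝ) else 2) * |besselJ j (β / d)|)
            ^ (d - (k + 1))
        * (2 * ∑' l : ℕ, |besselJ (l + J + 1) (β / d)|) ^ (k + 1)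
        * srwI d (n + 1) 0
            (fun μ : Fin d => if (μ : ℕ) < k + 1 then ((((J + 1) * M : ℕ)) : ℤ) else 0) := by
  have hd1 : 1 ≤ d := by omega
  have hd3 : 2 * n + 3 ≤ d := by omega
  have hd0 : (0 : ℝ) < d := by exact_mod_cast (by omega : 0 < d)
  have hπ : (0 : ℝ) < π := Real.pi_pos
  have hn0 : (n ! : ℝ) ≠ 0 := by positivity
  -- abbreviations
  set y : ℝ := β / d with hy
  set A : ℝ := ∑ j ∈ Finset.range (J + 1), (if j = 0 then (1 : ℝ) else 2) * |besselJ j y| with hA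
  set δ : ℝ := ∑' l : ℕ, |besselJ (l + J + 1) y| with hδ
  set c : ℤ := ((((J + 1) * M : ℕ)) : ℤ) with hc
  have hA0 : 0 ≤ A := Finset.sum_nonneg fun j _ => by
    have : (0:ℝ) ≤ (if j = 0 then (1 : ℝ) else 2) := by split_ifs <;> norm_num
    positivity
  have hδ0 : 0 ≤ δ := tsum_nonneg fun l => abs_nonneg _
  -- the functions of `τ`
  set Bf : ℝ → ℂ := fun τ => ∫ t, Complex.exp (((τ / d * Real.cos t : ℝ) : ℂ)
      + ((β / d * Real.cos (m * t) : ℝ) : ℂ) * Complex.I) ∂μI with hBf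
  set Pf : ℝ → ℂ := fun τ => ∑ j ∈ Finset.range (J + 1), (if j = 0 then (1 : ℂ) else 2)
      * ((besselI (j * m) (τ / d) : ℂ) * (2 * π * Complex.I ^ j * (besselJ j (β / d) : ℂ))) with hPf
  set f : ℝ → ℝ := fun τ => τ ^ n * (Real.exp (-τ) * ((Bf τ) ^ d).re) with hf
  set g : ℝ → ℝ := fun τ => τ ^ n * (Real.exp (-τ) * ((Pf τ) ^ d).re) with hg
  set pt : ℕ → Fin d → ℤ := fun k μ => if (μ : ℕ) < k + 1 then c else 0 with hpt
  set coef : ℕ → ℝ := fun k => (d.choose (k + 1) : ℝ) * A ^ (d - (k + 1)) * (2 * δ) ^ (k + 1)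
    with hcoef
  have hcoef0 : ∀ k, 0 ≤ coef k := fun k => by simp only [hcoef]; positivity
  set h : ℝ → ℝ := fun τ => ∑ k ∈ Finset.range d, ((2 * π) ^ d * coef k)
      * (τ ^ n * ∏ μ : Fin d, srwHeatKernel (τ / d) (pt k μ)) with hh
  -- Step 1: the Schwinger–Bessel form of the twisted seed
  have hrepr : srwTwist d (n + 1) (fun _ => 1) (Pi.single i m) β
      = (n ! : ℝ)⁻¹ * (∫ τ in Ioi (0:ℝ), f τ) / (2 * π) ^ d :=
    srwTwist_succ_one_single_eq_integral_axisTransform n hd i m β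
  -- Step 2: pointwise bounds for `τ > 0`
  have hP_le : ∀ τ : ℝ, 0 < τ → ‖Pf τ‖ ≤ 2 * π * A * besselI 0 (τ / d) := fun τ hτ =>
    norm_besselRow_sum_range_le (by positivity) y m J
  have hBP_le : ∀ τ : ℝ, 0 < τ → ‖Bf τ - Pf τ‖ ≤ 4 * π * besselI c (τ / d) * δ := by
    intro τ hτ
    have hv : 0 ≤ τ / d := by positivity
    have h1 := norm_sub_sum_range_le_of_hasSum_besselRow hv y m J
      (hasSum_besselRow_nat_μI (τ / d) y hm)
    have h2 : besselI (((J + 1 : ℕ) : ℤ) * m) (τ / d) ≤ besselI c (τ / d) := by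
      refine besselI_le_of_natAbs_le hv ?_
      simp only [hc, Int.natAbs_mul, Int.natAbs_natCast]
      exact Nat.mul_le_mul_left _ hM
    calc ‖Bf τ - Pf τ‖ ≤ 4 * π * besselI (((J + 1 : ℕ) : ℤ) * m) (τ / d) * δ := h1
      _ ≤ 4 * π * besselI c (τ / d) * δ := by gcongr
  have hB_le : ∀ τ : ℝ, 0 < τ → ‖Bf τ‖ ≤ 2 * π * (A + 2 * δ) * besselI 0 (τ / d) := by
    intro τ hτ
    have hv : 0 ≤ τ / d := by positivity
    have hc0 : besselI c (τ / d) ≤ besselI 0 (τ / d) := besselI_le_of_natAbs_le hv (by simp)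
    calc ‖Bf τ‖ = ‖Pf τ + (Bf τ - Pf τ)‖ := by rw [add_sub_cancel]
      _ ≤ ‖Pf τ‖ + ‖Bf τ - Pf τ‖ := norm_add_le _ _
      _ ≤ 2 * π * A * besselI 0 (τ / d) + 4 * π * besselI c (τ / d) * δ :=
          add_le_add (hP_le τ hτ) (hBP_le τ hτ)
      _ ≤ 2 * π * A * besselI 0 (τ / d) + 4 * π * besselI 0 (τ / d) * δ := by gcongr
      _ = 2 * π * (A + 2 * δ) * besselI 0 (τ / d) := by ring
  -- |f - g| ≤ h pointwise on `(0,∞)`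
  have hfg_le : ∀ τ : ℝ, 0 < τ → ‖f τ - g τ‖ ≤ h τ := by
    intro τ hτ
    have hv : 0 ≤ τ / d := by positivity
    have hI0 : 0 ≤ besselI 0 (τ / d) := besselI_nonneg hv 0
    have hIc : 0 ≤ besselI c (τ / d) := besselI_nonneg hv c
    set α : ℝ := 2 * π * A * besselI 0 (τ / d) with hα
    set ρ : ℝ := 4 * π * besselI c (τ / d) * δ with hρ
    have hα0 : 0 ≤ α := by positivity
    have hρ0 : 0 ≤ ρ := by positivity
    -- |Re B^d - Re P^d| ≤ (‖P‖+ρ)^d - ‖P‖^d ≤ (α+ρ)^d - α^d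
    have hre : |((Bf τ) ^ d).re - ((Pf τ) ^ d).re| ≤ (α + ρ) ^ d - α ^ d := by
      have h1 := abs_re_add_pow_sub_re_pow_le_of_norm_le (Pf τ) (Bf τ - Pf τ) (hBP_le τ hτ) d
      rw [add_sub_cancel] at h1
      exact h1.trans (add_pow_sub_pow_mono (norm_nonneg _) (hP_le τ hτ) hρ0 d)
    have hexp0 : 0 < Real.exp (-τ) := Real.exp_pos _
    have e1 : f τ - g τ = τ ^ n * Real.exp (-τ) * (((Bf τ) ^ d).re - ((Pf τ) ^ d).re) := by
      simp only [hf, hg]; ring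
    rw [e1, Real.norm_eq_abs, abs_mul, abs_of_nonneg (by positivity : (0:ℝ) ≤ τ ^ n * Real.exp (-τ))]
    calc τ ^ n * Real.exp (-τ) * |((Bf τ) ^ d).re - ((Pf τ) ^ d).re|
        ≤ τ ^ n * Real.exp (-τ) * ((α + ρ) ^ d - α ^ d) := by gcongr
      _ = τ ^ n * Real.exp (-τ) * ∑ k ∈ Finset.range d,
            (d.choose (k + 1) : ℝ) * α ^ (d - (k + 1)) * ρ ^ (k + 1) := by
          rw [add_pow_sub_pow_eq_sum]
      _ = h τ := by
          simp only [hh, hcoef, Finset.mul_sum]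
          refine Finset.sum_congr rfl fun k hk => ?_
          have hk' : k + 1 ≤ d := Finset.mem_range.1 hk
          rw [← exp_neg_mul_besselI_pow_mul_pow_eq_prod_srwHeatKernel hd1 hk' c τ]
          simp only [hα, hρ]
          rw [mul_pow, mul_pow, mul_pow, mul_pow, mul_pow]
          have e2 : (2 * π : ℝ) ^ d = (2 * π) ^ (d - (k + 1)) * (2 * π) ^ (k + 1) := by
            rw [← pow_add, Nat.sub_add_cancel hk']
          have e3 : (4 * π : ℝ) ^ (k + 1) = (2 * π) ^ (k + 1) * 2 ^ (k + 1) := by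
            rw [← mul_pow]; ring
          rw [e2, e3]
          ring
  -- Step 3: integrability
  have hcontI : ∀ a : ℤ, Continuous fun τ : ℝ => besselI a (τ / d) := by
    intro a
    have e : (fun τ : ℝ => besselI a (τ / d))
        = fun τ => Real.exp (τ / d) * srwHeatKernel (τ / d) a := by
      ext τ
      rw [srwHeatKernel_eq_exp_neg_mul_besselI, ← mul_assoc, ← Real.exp_add, add_neg_cancel,
        Real.exp_zero, one_mul]
    rw [e]
    exact ((Real.continuous_exp.comp (continuous_id.div_const _))).mul
      ((continuous_srwHeatKernel_left a).comp (continuous_id.div_const _))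
  have hPcont : Continuous Pf := by
    simp only [hPf]
    refine continuous_finsetSum _ fun j _ => continuous_const.mul ((?_ : Continuous _).mul continuous_const)
    exact Complex.continuous_ofReal.comp (hcontI _)
  have hgcont : Continuous g := by
    simp only [hg]
    exact (continuous_pow n).mul ((Real.continuous_exp.comp continuous_neg).mul
      (Complex.continuous_re.comp (hPcont.pow d)))
  have hBsm : StronglyMeasurable Bf := by
    have hF : Continuous (Function.uncurry fun (τ t : ℝ) => Complex.exp (((τ / d * Real.cos t : ℝ) : ℂ)
        + ((β / d * Real.cos (m * t) : ℝ) : ℂ) * Complex.I)) := by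
      show Continuous fun p : ℝ × ℝ => Complex.exp (((p.1 / d * Real.cos p.2 : ℝ) : ℂ)
        + ((β / d * Real.cos (m * p.2) : ℝ) : ℂ) * Complex.I)
      fun_prop
    exact hF.stronglyMeasurable.integral_prod_right (ν := μI)
  have hfsm : AEStronglyMeasurable f (volume.restrict (Ioi 0)) := by
    have h1 : StronglyMeasurable f := by
      simp only [hf]
      refine (continuous_pow n).stronglyMeasurable.mul
        ((Real.continuous_exp.comp continuous_neg).stronglyMeasurable.mul ?_)
      exact Complex.continuous_re.comp_stronglyMeasurable (hBsm.pow d)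
    exact h1.aestronglyMeasurable
  have hI0int := integrableOn_pow_mul_srwHeatKernel_zero_pow n hd3
  -- |g| ≤ (2πA)^d τ^n q_{τ/d}(0)^d, |f| ≤ (2π(A+2δ))^d τ^n q_{τ/d}(0)^d
  have hdom : ∀ (C : ℝ) (F : ℝ → ℂ), 0 ≤ C → (∀ τ : ℝ, 0 < τ → ‖F τ‖ ≤ C * besselI 0 (τ / d)) →
      ∀ τ : ℝ, 0 < τ → ‖τ ^ n * (Real.exp (-τ) * ((F τ) ^ d).re)‖
        ≤ C ^ d * (τ ^ n * srwHeatKernel (τ / d) 0 ^ d) := by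
    intro C F hC hF τ hτ
    have hv : 0 ≤ τ / d := by positivity
    have hq : Real.exp (-τ) * besselI 0 (τ / d) ^ d = srwHeatKernel (τ / d) 0 ^ d := by
      have := exp_neg_mul_besselI_pow_mul_pow_eq_prod_srwHeatKernel hd1 (le_refl d) 0 τ
      rw [Nat.sub_self, pow_zero, mul_one] at this
      rw [this]
      have e : ∀ μ : Fin d, (if (μ : ℕ) < d then (0:ℤ) else 0) = 0 := fun μ => by split_ifs <;> rfl
      simp_rw [e]
      rw [Fin.prod_const]
    have hre : |((F τ) ^ d).re| ≤ (C * besselI 0 (τ / d)) ^ d := by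
      calc |((F τ) ^ d).re| ≤ ‖(F τ) ^ d‖ := Complex.abs_re_le_norm _
        _ = ‖F τ‖ ^ d := norm_pow _ _
        _ ≤ (C * besselI 0 (τ / d)) ^ d := pow_le_pow_left₀ (norm_nonneg _) (hF τ hτ) d
    rw [norm_mul, norm_mul, Real.norm_eq_abs, Real.norm_eq_abs, Real.norm_eq_abs,
      abs_of_nonneg (pow_nonneg hτ.le n), abs_of_pos (Real.exp_pos _)]
    calc τ ^ n * (Real.exp (-τ) * |((F τ) ^ d).re|)
        ≤ τ ^ n * (Real.exp (-τ) * (C * besselI 0 (τ / d)) ^ d) := by gcongr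
      _ = C ^ d * (τ ^ n * (Real.exp (-τ) * besselI 0 (τ / d) ^ d)) := by rw [mul_pow]; ring
      _ = C ^ d * (τ ^ n * srwHeatKernel (τ / d) 0 ^ d) := by rw [hq]
  have hgint : Integrable g (volume.restrict (Ioi 0)) := by
    refine Integrable.mono' ((hI0int.const_mul ((2 * π * A) ^ d))) hgcont.aestronglyMeasurable ?_
    rw [ae_restrict_iff' measurableSet_Ioi]
    exact Eventually.of_forall fun τ hτ => hdom (2 * π * A) Pf (by positivity) hP_le τ hτ
  have hfint : Integrable f (volume.restrict (Ioi 0)) := by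
    refine Integrable.mono' ((hI0int.const_mul ((2 * π * (A + 2 * δ)) ^ d))) hfsm ?_
    rw [ae_restrict_iff' measurableSet_Ioi]
    exact Eventually.of_forall fun τ hτ => hdom (2 * π * (A + 2 * δ)) Bf (by positivity) hB_le τ hτ
  have hhint : Integrable h (volume.restrict (Ioi 0)) := by
    simp only [hh]
    refine integrable_finsetSum _ fun k hk => ?_
    exact ((integrableOn_pow_mul_prod_srwHeatKernel n hd3 (pt k)).const_mul _)
  -- Step 4: the integral of the majorant is the sum of seeds
  have hh_int : ∫ τ in Ioi (0:ℝ), h τ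
      = ∑ k ∈ Finset.range d, ((2 * π) ^ d * coef k) * ((n ! : ℝ) * srwI d (n + 1) 0 (pt k)) := by
    simp only [hh]
    rw [integral_finsetSum _ (fun k _ =>
      ((integrableOn_pow_mul_prod_srwHeatKernel n hd3 (pt k)).const_mul _))]
    refine Finset.sum_congr rfl fun k _ => ?_
    rw [integral_const_mul]
    congr 1
    rw [srwI_succ_zero_eq_integral_prod_srwHeatKernel_div n hd3 (pt k)]
    field_simp
  -- Step 5: assemble
  have hdiff : srwTwist d (n + 1) (fun _ => 1) (Pi.single i m) β
      - (n ! : ℝ)⁻¹ * (∫ τ in Ioi (0:ℝ), g τ) / (2 * π) ^ d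
      = (n ! : ℝ)⁻¹ * (∫ τ in Ioi (0:ℝ), (f τ - g τ)) / (2 * π) ^ d := by
    rw [hrepr, integral_sub hfint hgint]
    ring
  have hnorm : ‖∫ τ in Ioi (0:ℝ), (f τ - g τ)‖ ≤ ∫ τ in Ioi (0:ℝ), h τ := by
    refine norm_integral_le_of_norm_le hhint ?_
    rw [ae_restrict_iff' measurableSet_Ioi]
    exact Eventually.of_forall fun τ hτ => hfg_le τ hτ
  show |srwTwist d (n + 1) (fun _ => 1) (Pi.single i m) β
      - (n ! : ℝ)⁻¹ * (∫ τ in Ioi (0:ℝ), g τ) / (2 * π) ^ d|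
    ≤ ∑ k ∈ Finset.range d, coef k * srwI d (n + 1) 0 (pt k)
  rw [hdiff, abs_div, abs_mul, abs_of_pos (by positivity : (0:ℝ) < (n ! : ℝ)⁻¹),
    abs_of_pos (by positivity : (0:ℝ) < (2 * π) ^ d), ← Real.norm_eq_abs]
  calc (n ! : ℝ)⁻¹ * ‖∫ τ in Ioi (0:ℝ), (f τ - g τ)‖ / (2 * π) ^ d
      ≤ (n ! : ℝ)⁻¹ * (∫ τ in Ioi (0:ℝ), h τ) / (2 * π) ^ d := by gcongr
    _ = ∑ k ∈ Finset.range d, coef k * srwI d (n + 1) 0 (pt k) := by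
        rw [hh_int, Finset.mul_sum, Finset.sum_div]
        refine Finset.sum_congr rfl fun k _ => ?_
        field_simp

/-- **`‖B_m(v,y)‖ ≤ 2π I_0(v)`**: the twisted one-coordinate transform is bounded by the
untwisted one, `|e^{iy cos(mt)}| = 1` and `∫_{-π}^{π} e^{v cos t} dt = 2π I_0(v)`.
[cite: FitznerVanDerHofstad2016NoBLE, §5.1.1 (5.2)–(5.4); DLMF, 10.32.1] -/
theorem norm_axisTransform_μI_le (v y : ℝ) (m : ℤ) :
    ‖∫ t, Complex.exp (((v * Real.cos t : ℝ) : ℂ) + ((y * Real.cos (m * t) : ℝ) : ℂ) * Complex.I) ∂μI‖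
      ≤ 2 * π * besselI 0 v := by
  have hnorm : ∀ t : ℝ, ‖Complex.exp (((v * Real.cos t : ℝ) : ℂ)
      + ((y * Real.cos (m * t) : ℝ) : ℂ) * Complex.I)‖ = Real.exp (v * Real.cos t) := by
    intro t
    rw [Complex.norm_exp, Complex.add_re, Complex.ofReal_re, Complex.mul_I_re, Complex.ofReal_im,
      neg_zero, add_zero]
  have hI : ∫ t, Real.exp (v * Real.cos t) ∂μI = 2 * π * besselI 0 v := by
    rw [show μI = volume.restrict (Icc (-π) π) from rfl, integral_Icc_eq_integral_Ioc,
      ← intervalIntegral.integral_of_le (by linarith [Real.pi_pos] : -π ≤ π)]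
    have hq : 2 * π * srwHeatKernel v 0 = ∫ k in (-π)..π, Real.exp (-(v * (1 - Real.cos k))) := by
      simp only [srwHeatKernel, Int.cast_zero, mul_zero, Real.cos_zero, one_mul]
      field_simp
    have e1 : ∀ k : ℝ, Real.exp (v * Real.cos k)
        = Real.exp v * Real.exp (-(v * (1 - Real.cos k))) := by
      intro k
      rw [← Real.exp_add]
      congr 1; ring
    have e2 : Real.exp v * Real.exp (-v) = 1 := by
      rw [← Real.exp_add, add_neg_cancel, Real.exp_zero]
    simp_rw [e1]
    rw [intervalIntegral.integral_const_mul, ← hq, srwHeatKernel_eq_exp_neg_mul_besselI]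
    calc Real.exp v * (2 * π * (Real.exp (-v) * besselI 0 v))
        = 2 * π * (Real.exp v * Real.exp (-v)) * besselI 0 v := by ring
      _ = 2 * π * besselI 0 v := by rw [e2, mul_one]
  calc ‖∫ t, Complex.exp (((v * Real.cos t : ℝ) : ℂ) + ((y * Real.cos (m * t) : ℝ) : ℂ) * Complex.I) ∂μI‖
      ≤ ∫ t, ‖Complex.exp (((v * Real.cos t : ℝ) : ℂ) + ((y * Real.cos (m * t) : ℝ) : ℂ) * Complex.I)‖ ∂μI :=
        norm_integral_le_integral_norm _
    _ = 2 * π * besselI 0 v := by simp_rw [hnorm]; exact hI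

/-- **Row truncation costs plain seeds — unit-anchored form (no `A_J`).** Same setting; anchoring the
power perturbation at `B_m` itself (`‖B_m(v,y)‖ ≤ 2π I_0(v)` since `|e^{iy cos}| = 1`) instead of at
`P_J` replaces the coefficient 1-norm `A_J` by `1`:
`… ≤ Σ_{k<d} C(d,k+1) (2δ_J(β/d))^{k+1} · srwI d (n+1) 0 x_{k+1}` — the form to use for `J ≥ 1`
(by value `A_J ≈ 1.5–2.9` at `y ≤ 3`, so `A_J^{d-1}` is large, enum1-g50), while for `J = 0` the
`A_0 = |J_0(y)| ≤ 1` form above is the better one.  ORIGINAL DOCSTRING of the `A_J` form follows for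
reference. **Row truncation of the twisted axis seed costs plain seeds.** For `d ≥ 2n+3`, `m ≠ 0`, every `β`,
every truncation order `J` and every `M ≤ |m|`:
`|srwTwist d (n+1) 1 (m e_i) β − (n!)⁻¹(∫₀^∞ τⁿ e^{-τ} Re P_J(τ/d, β/d)^d dτ)/(2π)^d|`
`≤ Σ_{k<d} C(d,k+1) A_J(β/d)^{d-(k+1)} (2δ_J(β/d))^{k+1} · srwI d (n+1) 0 x_{k+1}`,
`x_k = ((J+1)M)·(e_0 + … + e_{k-1})`, `A_J(y) = Σ_{j≤J} ε_j|J_j(y)|`, `δ_J(y) = Σ_{l≥0}|J_{l+J+1}(y)|`.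
With `J = 0` this is the m-uniform row device (all `|m| ≥ M` at once); for general `J` it is the
order-ball budget of a twisted-seed certificate — in both cases the right-hand side is plain seeds.
[cite: FitznerVanDerHofstad2016NoBLE, (3.34)–(3.36) p. 1071, §5.1.1 (5.2)–(5.5); DLMF, 10.35.2, 10.14.4] -/
theorem abs_srwTwist_sub_rowTrunc_le_sum_srwI_unit (n : ℕ) (hd : 2 * (n + 1) + 1 ≤ d) (i : Fin d)
    {m : ℤ} (hm : m ≠ 0) (β : ℝ) (J M : ℕ) (hM : M ≤ m.natAbs) :
    |srwTwist d (n + 1) (fun _ => 1) (Pi.single i m) β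
      - (n ! : ℝ)⁻¹ * (∫ τ in Ioi (0:ℝ), τ ^ n * (Real.exp (-τ) *
          ((∑ j ∈ Finset.range (J + 1), (if j = 0 then (1 : ℂ) else 2)
            * ((besselI (j * m) (τ / d) : ℂ)
              * (2 * π * Complex.I ^ j * (besselJ j (β / d) : ℂ)))) ^ d).re))
        / (2 * π) ^ d|
    ≤ ∑ k ∈ Finset.range d, (d.choose (k + 1) : ℝ)
        * (2 * ∑' l : ℕ, |besselJ (l + J + 1) (β / d)|) ^ (k + 1)
        * srwI d (n + 1) 0
            (fun μ : Fin d => if (μ : ℕ) < k + 1 then ((((J + 1) * M : ℕ)) : ℤ) else 0) := by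
  have hd1 : 1 ≤ d := by omega
  have hd3 : 2 * n + 3 ≤ d := by omega
  have hd0 : (0 : ℝ) < d := by exact_mod_cast (by omega : 0 < d)
  have hπ : (0 : ℝ) < π := Real.pi_pos
  have hn0 : (n ! : ℝ) ≠ 0 := by positivity
  -- abbreviations
  set y : ℝ := β / d with hy
  set A : ℝ := ∑ j ∈ Finset.range (J + 1), (if j = 0 then (1 : ℝ) else 2) * |besselJ j y| with hA
  set δ : ℝ := ∑' l : ℕ, |besselJ (l + J + 1) y| with hδ
  set c : ℤ := ((((J + 1) * M : ℕ)) : ℤ) with hc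
  have hA0 : 0 ≤ A := Finset.sum_nonneg fun j _ => by
    have : (0:ℝ) ≤ (if j = 0 then (1 : ℝ) else 2) := by split_ifs <;> norm_num
    positivity
  have hδ0 : 0 ≤ δ := tsum_nonneg fun l => abs_nonneg _
  -- the functions of `τ`
  set Bf : ℝ → ℂ := fun τ => ∫ t, Complex.exp (((τ / d * Real.cos t : ℝ) : ℂ)
      + ((β / d * Real.cos (m * t) : ℝ) : ℂ) * Complex.I) ∂μI with hBf
  set Pf : ℝ → ℂ := fun τ => ∑ j ∈ Finset.range (J + 1), (if j = 0 then (1 : ℂ) else 2)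
      * ((besselI (j * m) (τ / d) : ℂ) * (2 * π * Complex.I ^ j * (besselJ j (β / d) : ℂ))) with hPf
  set f : ℝ → ℝ := fun τ => τ ^ n * (Real.exp (-τ) * ((Bf τ) ^ d).re) with hf
  set g : ℝ → ℝ := fun τ => τ ^ n * (Real.exp (-τ) * ((Pf τ) ^ d).re) with hg
  set pt : ℕ → Fin d → ℤ := fun k μ => if (μ : ℕ) < k + 1 then c else 0 with hpt
  set coef : ℕ → ℝ := fun k => (d.choose (k + 1) : ℝ) * (2 * δ) ^ (k + 1)
    with hcoef
  have hcoef0 : ∀ k, 0 ≤ coef k := fun k => by simp only [hcoef]; positivity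
  set h : ℝ → ℝ := fun τ => ∑ k ∈ Finset.range d, ((2 * π) ^ d * coef k)
      * (τ ^ n * ∏ μ : Fin d, srwHeatKernel (τ / d) (pt k μ)) with hh
  -- Step 1: the Schwinger–Bessel form of the twisted seed
  have hrepr : srwTwist d (n + 1) (fun _ => 1) (Pi.single i m) β
      = (n ! : ℝ)⁻¹ * (∫ τ in Ioi (0:ℝ), f τ) / (2 * π) ^ d :=
    srwTwist_succ_one_single_eq_integral_axisTransform n hd i m β
  -- Step 2: pointwise bounds for `τ > 0`
  have hB1 : ∀ τ : ℝ, 0 < τ → ‖Bf τ‖ ≤ 2 * π * 1 * besselI 0 (τ / d) := fun τ hτ => by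
    rw [mul_one]; exact norm_axisTransform_μI_le (τ / d) (β / d) m
  have hBP_le : ∀ τ : ℝ, 0 < τ → ‖Bf τ - Pf τ‖ ≤ 4 * π * besselI c (τ / d) * δ := by
    intro τ hτ
    have hv : 0 ≤ τ / d := by positivity
    have h1 := norm_sub_sum_range_le_of_hasSum_besselRow hv y m J
      (hasSum_besselRow_nat_μI (τ / d) y hm)
    have h2 : besselI (((J + 1 : ℕ) : ℤ) * m) (τ / d) ≤ besselI c (τ / d) := by
      refine besselI_le_of_natAbs_le hv ?_
      simp only [hc, Int.natAbs_mul, Int.natAbs_natCast]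
      exact Nat.mul_le_mul_left _ hM
    calc ‖Bf τ - Pf τ‖ ≤ 4 * π * besselI (((J + 1 : ℕ) : ℤ) * m) (τ / d) * δ := h1
      _ ≤ 4 * π * besselI c (τ / d) * δ := by gcongr
  have hP_le' : ∀ τ : ℝ, 0 < τ → ‖Pf τ‖ ≤ 2 * π * (1 + 2 * δ) * besselI 0 (τ / d) := by
    intro τ hτ
    have hv : 0 ≤ τ / d := by positivity
    have hc0 : besselI c (τ / d) ≤ besselI 0 (τ / d) := besselI_le_of_natAbs_le hv (by simp)
    calc ‖Pf τ‖ = ‖Bf τ - (Bf τ - Pf τ)‖ := by rw [sub_sub_cancel]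
      _ ≤ ‖Bf τ‖ + ‖Bf τ - Pf τ‖ := norm_sub_le _ _
      _ ≤ 2 * π * 1 * besselI 0 (τ / d) + 4 * π * besselI c (τ / d) * δ :=
          add_le_add (hB1 τ hτ) (hBP_le τ hτ)
      _ ≤ 2 * π * 1 * besselI 0 (τ / d) + 4 * π * besselI 0 (τ / d) * δ := by gcongr
      _ = 2 * π * (1 + 2 * δ) * besselI 0 (τ / d) := by ring
  -- |f - g| ≤ h pointwise on `(0,∞)`
  have hfg_le : ∀ τ : ℝ, 0 < τ → ‖f τ - g τ‖ ≤ h τ := by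
    intro τ hτ
    have hv : 0 ≤ τ / d := by positivity
    have hI0 : 0 ≤ besselI 0 (τ / d) := besselI_nonneg hv 0
    have hIc : 0 ≤ besselI c (τ / d) := besselI_nonneg hv c
    set α : ℝ := 2 * π * 1 * besselI 0 (τ / d) with hα
    set ρ : ℝ := 4 * π * besselI c (τ / d) * δ with hρ
    have hα0 : 0 ≤ α := by positivity
    have hρ0 : 0 ≤ ρ := by positivity
    -- |Re B^d - Re P^d| ≤ (‖B‖+ρ)^d - ‖B‖^d ≤ (α+ρ)^d - α^d  (anchored at B)
    have hre : |((Bf τ) ^ d).re - ((Pf τ) ^ d).re| ≤ (α + ρ) ^ d - α ^ d := by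
      have hPB : ‖Pf τ - Bf τ‖ ≤ ρ := by rw [norm_sub_rev]; exact hBP_le τ hτ
      have h1 := abs_re_add_pow_sub_re_pow_le_of_norm_le (Bf τ) (Pf τ - Bf τ) hPB d
      rw [add_sub_cancel, abs_sub_comm] at h1
      exact h1.trans (add_pow_sub_pow_mono (norm_nonneg _) (hB1 τ hτ) hρ0 d)
    have hexp0 : 0 < Real.exp (-τ) := Real.exp_pos _
    have e1 : f τ - g τ = τ ^ n * Real.exp (-τ) * (((Bf τ) ^ d).re - ((Pf τ) ^ d).re) := by
      simp only [hf, hg]; ring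
    rw [e1, Real.norm_eq_abs, abs_mul, abs_of_nonneg (by positivity : (0:ℝ) ≤ τ ^ n * Real.exp (-τ))]
    calc τ ^ n * Real.exp (-τ) * |((Bf τ) ^ d).re - ((Pf τ) ^ d).re|
        ≤ τ ^ n * Real.exp (-τ) * ((α + ρ) ^ d - α ^ d) := by gcongr
      _ = τ ^ n * Real.exp (-τ) * ∑ k ∈ Finset.range d,
            (d.choose (k + 1) : ℝ) * α ^ (d - (k + 1)) * ρ ^ (k + 1) := by
          rw [add_pow_sub_pow_eq_sum]
      _ = h τ := by
          simp only [hh, hcoef, Finset.mul_sum]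
          refine Finset.sum_congr rfl fun k hk => ?_
          have hk' : k + 1 ≤ d := Finset.mem_range.1 hk
          rw [← exp_neg_mul_besselI_pow_mul_pow_eq_prod_srwHeatKernel hd1 hk' c τ]
          simp only [hα, hρ, mul_one]
          rw [mul_pow, mul_pow, mul_pow, mul_pow]
          have e2 : (2 * π : ℝ) ^ d = (2 * π) ^ (d - (k + 1)) * (2 * π) ^ (k + 1) := by
            rw [← pow_add, Nat.sub_add_cancel hk']
          have e3 : (4 * π : ℝ) ^ (k + 1) = (2 * π) ^ (k + 1) * 2 ^ (k + 1) := by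
            rw [← mul_pow]; ring
          rw [e2, e3]
          ring
  -- Step 3: integrability
  have hcontI : ∀ a : ℤ, Continuous fun τ : ℝ => besselI a (τ / d) := by
    intro a
    have e : (fun τ : ℝ => besselI a (τ / d))
        = fun τ => Real.exp (τ / d) * srwHeatKernel (τ / d) a := by
      ext τ
      rw [srwHeatKernel_eq_exp_neg_mul_besselI, ← mul_assoc, ← Real.exp_add, add_neg_cancel,
        Real.exp_zero, one_mul]
    rw [e]
    exact ((Real.continuous_exp.comp (continuous_id.div_const _))).mul
      ((continuous_srwHeatKernel_left a).comp (continuous_id.div_const _))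
  have hPcont : Continuous Pf := by
    simp only [hPf]
    refine continuous_finsetSum _ fun j _ => continuous_const.mul ((?_ : Continuous _).mul continuous_const)
    exact Complex.continuous_ofReal.comp (hcontI _)
  have hgcont : Continuous g := by
    simp only [hg]
    exact (continuous_pow n).mul ((Real.continuous_exp.comp continuous_neg).mul
      (Complex.continuous_re.comp (hPcont.pow d)))
  have hBsm : StronglyMeasurable Bf := by
    have hF : Continuous (Function.uncurry fun (τ t : ℝ) => Complex.exp (((τ / d * Real.cos t : ℝ) : ℂ)
        + ((β / d * Real.cos (m * t) : ℝ) : ℂ) * Complex.I)) := by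
      show Continuous fun p : ℝ × ℝ => Complex.exp (((p.1 / d * Real.cos p.2 : ℝ) : ℂ)
        + ((β / d * Real.cos (m * p.2) : ℝ) : ℂ) * Complex.I)
      fun_prop
    exact hF.stronglyMeasurable.integral_prod_right (ν := μI)
  have hfsm : AEStronglyMeasurable f (volume.restrict (Ioi 0)) := by
    have h1 : StronglyMeasurable f := by
      simp only [hf]
      refine (continuous_pow n).stronglyMeasurable.mul
        ((Real.continuous_exp.comp continuous_neg).stronglyMeasurable.mul ?_)
      exact Complex.continuous_re.comp_stronglyMeasurable (hBsm.pow d)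
    exact h1.aestronglyMeasurable
  have hI0int := integrableOn_pow_mul_srwHeatKernel_zero_pow n hd3
  -- |g| ≤ (2πA)^d τ^n q_{τ/d}(0)^d, |f| ≤ (2π(A+2δ))^d τ^n q_{τ/d}(0)^d
  have hdom : ∀ (C : ℝ) (F : ℝ → ℂ), 0 ≤ C → (∀ τ : ℝ, 0 < τ → ‖F τ‖ ≤ C * besselI 0 (τ / d)) →
      ∀ τ : ℝ, 0 < τ → ‖τ ^ n * (Real.exp (-τ) * ((F τ) ^ d).re)‖
        ≤ C ^ d * (τ ^ n * srwHeatKernel (τ / d) 0 ^ d) := by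
    intro C F hC hF τ hτ
    have hv : 0 ≤ τ / d := by positivity
    have hq : Real.exp (-τ) * besselI 0 (τ / d) ^ d = srwHeatKernel (τ / d) 0 ^ d := by
      have := exp_neg_mul_besselI_pow_mul_pow_eq_prod_srwHeatKernel hd1 (le_refl d) 0 τ
      rw [Nat.sub_self, pow_zero, mul_one] at this
      rw [this]
      have e : ∀ μ : Fin d, (if (μ : ℕ) < d then (0:ℤ) else 0) = 0 := fun μ => by split_ifs <;> rfl
      simp_rw [e]
      rw [Fin.prod_const]
    have hre : |((F τ) ^ d).re| ≤ (C * besselI 0 (τ / d)) ^ d := by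
      calc |((F τ) ^ d).re| ≤ ‖(F τ) ^ d‖ := Complex.abs_re_le_norm _
        _ = ‖F τ‖ ^ d := norm_pow _ _
        _ ≤ (C * besselI 0 (τ / d)) ^ d := pow_le_pow_left₀ (norm_nonneg _) (hF τ hτ) d
    rw [norm_mul, norm_mul, Real.norm_eq_abs, Real.norm_eq_abs, Real.norm_eq_abs,
      abs_of_nonneg (pow_nonneg hτ.le n), abs_of_pos (Real.exp_pos _)]
    calc τ ^ n * (Real.exp (-τ) * |((F τ) ^ d).re|)
        ≤ τ ^ n * (Real.exp (-τ) * (C * besselI 0 (τ / d)) ^ d) := by gcongr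
      _ = C ^ d * (τ ^ n * (Real.exp (-τ) * besselI 0 (τ / d) ^ d)) := by rw [mul_pow]; ring
      _ = C ^ d * (τ ^ n * srwHeatKernel (τ / d) 0 ^ d) := by rw [hq]
  have hgint : Integrable g (volume.restrict (Ioi 0)) := by
    refine Integrable.mono' ((hI0int.const_mul ((2 * π * (1 + 2 * δ)) ^ d))) hgcont.aestronglyMeasurable ?_
    rw [ae_restrict_iff' measurableSet_Ioi]
    exact Eventually.of_forall fun τ hτ => hdom (2 * π * (1 + 2 * δ)) Pf (by positivity) hP_le' τ hτ
  have hfint : Integrable f (volume.restrict (Ioi 0)) := by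
    refine Integrable.mono' ((hI0int.const_mul ((2 * π * 1) ^ d))) hfsm ?_
    rw [ae_restrict_iff' measurableSet_Ioi]
    exact Eventually.of_forall fun τ hτ => hdom (2 * π * 1) Bf (by positivity) hB1 τ hτ
  have hhint : Integrable h (volume.restrict (Ioi 0)) := by
    simp only [hh]
    refine integrable_finsetSum _ fun k hk => ?_
    exact ((integrableOn_pow_mul_prod_srwHeatKernel n hd3 (pt k)).const_mul _)
  -- Step 4: the integral of the majorant is the sum of seeds
  have hh_int : ∫ τ in Ioi (0:ℝ), h τ
      = ∑ k ∈ Finset.range d, ((2 * π) ^ d * coef k) * ((n ! : ℝ) * srwI d (n + 1) 0 (pt k)) := by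
    simp only [hh]
    rw [integral_finsetSum _ (fun k _ =>
      ((integrableOn_pow_mul_prod_srwHeatKernel n hd3 (pt k)).const_mul _))]
    refine Finset.sum_congr rfl fun k _ => ?_
    rw [integral_const_mul]
    congr 1
    rw [srwI_succ_zero_eq_integral_prod_srwHeatKernel_div n hd3 (pt k)]
    field_simp
  -- Step 5: assemble
  have hdiff : srwTwist d (n + 1) (fun _ => 1) (Pi.single i m) β
      - (n ! : ℝ)⁻¹ * (∫ τ in Ioi (0:ℝ), g τ) / (2 * π) ^ d
      = (n ! : ℝ)⁻¹ * (∫ τ in Ioi (0:ℝ), (f τ - g τ)) / (2 * π) ^ d := by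
    rw [hrepr, integral_sub hfint hgint]
    ring
  have hnorm : ‖∫ τ in Ioi (0:ℝ), (f τ - g τ)‖ ≤ ∫ τ in Ioi (0:ℝ), h τ := by
    refine norm_integral_le_of_norm_le hhint ?_
    rw [ae_restrict_iff' measurableSet_Ioi]
    exact Eventually.of_forall fun τ hτ => hfg_le τ hτ
  show |srwTwist d (n + 1) (fun _ => 1) (Pi.single i m) β
      - (n ! : ℝ)⁻¹ * (∫ τ in Ioi (0:ℝ), g τ) / (2 * π) ^ d|
    ≤ ∑ k ∈ Finset.range d, coef k * srwI d (n + 1) 0 (pt k)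
  rw [hdiff, abs_div, abs_mul, abs_of_pos (by positivity : (0:ℝ) < (n ! : ℝ)⁻¹),
    abs_of_pos (by positivity : (0:ℝ) < (2 * π) ^ d), ← Real.norm_eq_abs]
  calc (n ! : ℝ)⁻¹ * ‖∫ τ in Ioi (0:ℝ), (f τ - g τ)‖ / (2 * π) ^ d
      ≤ (n ! : ℝ)⁻¹ * (∫ τ in Ioi (0:ℝ), h τ) / (2 * π) ^ d := by gcongr
    _ = ∑ k ∈ Finset.range d, coef k * srwI d (n + 1) 0 (pt k) := by
        rw [hh_int, Finset.mul_sum, Finset.sum_div]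
        refine Finset.sum_congr rfl fun k _ => ?_
        field_simp

/-! ### Coefficient perturbation: exact rational rows, error paid by the origin seed -/

/-- Norm of a finite row with arbitrary coefficients: `‖Σ_{j≤J} ε_j I_{jm}(v) c_j‖ ≤ (Σ_j ε_j‖c_j‖)·I_0(v)`
(`v ≥ 0`, `I_{jm} ≤ I_0`). [cite: DLMF, 10.37] -/
theorem norm_row_sum_range_le {v : ℝ} (hv : 0 ≤ v) (m : ℤ) (J : ℕ) (c : ℕ → ℂ) :
    ‖∑ j ∈ Finset.range (J + 1), (if j = 0 then (1 : ℂ) else 2) * ((besselI (j * m) v : ℂ) * c j)‖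
      ≤ (∑ j ∈ Finset.range (J + 1), (if j = 0 then (1 : ℝ) else 2) * ‖c j‖) * besselI 0 v := by
  refine (norm_sum_le _ _).trans ?_
  rw [Finset.sum_mul]
  refine Finset.sum_le_sum fun j _ => ?_
  have hε : (0 : ℝ) ≤ (if j = 0 then (1 : ℝ) else 2) := by split_ifs <;> norm_num
  have hεn : ‖(if j = 0 then (1 : ℂ) else 2)‖ = (if j = 0 then (1 : ℝ) else 2) := by
    split_ifs <;> simp
  have hI : 0 ≤ besselI (j * m) v := besselI_nonneg hv _
  have hI0 : besselI (j * m) v ≤ besselI 0 v := besselI_le_of_natAbs_le hv (by simp)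
  rw [norm_mul, norm_mul, hεn, Complex.norm_real, Real.norm_eq_abs, abs_of_nonneg hI]
  calc (if j = 0 then (1 : ℝ) else 2) * (besselI (j * m) v * ‖c j‖)
      ≤ (if j = 0 then (1 : ℝ) else 2) * (besselI 0 v * ‖c j‖) := by gcongr
    _ = (if j = 0 then (1 : ℝ) else 2) * ‖c j‖ * besselI 0 v := by ring

/-- **Coefficient perturbation of a finite row costs the origin seed.** For `d ≥ 2n+3`, any `m`, any
truncation order `J` and ANY two coefficient vectors `c, c' : ℕ → ℂ` (e.g. `c_j = 2π iʲ J_j(β/d)` and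
`c'_j = 2π iʲ q_j` with rationals `q_j`), the row objects
`S(c) = (n!)⁻¹ (∫₀^∞ τⁿ e^{-τ} Re(Σ_{j≤J} ε_j I_{jm}(τ/d) c_j)^d dτ)/(2π)^d` satisfy
`|S(c) − S(c')| ≤ ((α' + η)^d − α'^d)/(2π)^d · I_{n+1,0}(0; d)`, `α' = Σ_j ε_j‖c'_j‖`, `η = Σ_j ε_j‖c_j − c'_j‖`:
the kernel may work with EXACT (complex-)rational rows and pay the coefficient error outside, as a
multiple of the plain origin seed. [cite: FitznerVanDerHofstad2016NoBLE, (3.34)–(3.36) p. 1071,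
§5.1.1 (5.2)–(5.5); DLMF, 10.35.2, 10.37] -/
theorem abs_rowObj_sub_rowObj_le_incr_mul_srwI_zero (n : ℕ) (hd : 2 * (n + 1) + 1 ≤ d) (m : ℤ) (J : ℕ)
    (c c' : ℕ → ℂ) :
    |(n ! : ℝ)⁻¹ * (∫ τ in Ioi (0:ℝ), τ ^ n * (Real.exp (-τ) *
        ((∑ j ∈ Finset.range (J + 1), (if j = 0 then (1 : ℂ) else 2)
          * ((besselI (j * m) (τ / d) : ℂ) * c j)) ^ d).re)) / (2 * π) ^ d
      - (n ! : ℝ)⁻¹ * (∫ τ in Ioi (0:ℝ), τ ^ n * (Real.exp (-τ) *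
        ((∑ j ∈ Finset.range (J + 1), (if j = 0 then (1 : ℂ) else 2)
          * ((besselI (j * m) (τ / d) : ℂ) * c' j)) ^ d).re)) / (2 * π) ^ d|
    ≤ (((∑ j ∈ Finset.range (J + 1), (if j = 0 then (1 : ℝ) else 2) * ‖c' j‖)
          + ∑ j ∈ Finset.range (J + 1), (if j = 0 then (1 : ℝ) else 2) * ‖c j - c' j‖) ^ d
        - (∑ j ∈ Finset.range (J + 1), (if j = 0 then (1 : ℝ) else 2) * ‖c' j‖) ^ d) / (2 * π) ^ d
      * srwI d (n + 1) 0 (fun _ : Fin d => 0) := by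
  have hd1 : 1 ≤ d := by omega
  have hd3 : 2 * n + 3 ≤ d := by omega
  have hd0 : (0 : ℝ) < d := by exact_mod_cast (by omega : 0 < d)
  have hπ : (0 : ℝ) < π := Real.pi_pos
  have hn0 : (n ! : ℝ) ≠ 0 := by positivity
  set α : ℝ := ∑ j ∈ Finset.range (J + 1), (if j = 0 then (1 : ℝ) else 2) * ‖c' j‖ with hα
  set η : ℝ := ∑ j ∈ Finset.range (J + 1), (if j = 0 then (1 : ℝ) else 2) * ‖c j - c' j‖ with hη
  have hε0 : ∀ j : ℕ, (0:ℝ) ≤ (if j = 0 then (1 : ℝ) else 2) := fun j => by split_ifs <;> norm_num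
  have hα0 : 0 ≤ α := Finset.sum_nonneg fun j _ => mul_nonneg (hε0 j) (norm_nonneg _)
  have hη0 : 0 ≤ η := Finset.sum_nonneg fun j _ => mul_nonneg (hε0 j) (norm_nonneg _)
  set P : (ℕ → ℂ) → ℝ → ℂ := fun b τ => ∑ j ∈ Finset.range (J + 1), (if j = 0 then (1 : ℂ) else 2)
      * ((besselI (j * m) (τ / d) : ℂ) * b j) with hP
  set g : (ℕ → ℂ) → ℝ → ℝ := fun b τ => τ ^ n * (Real.exp (-τ) * ((P b τ) ^ d).re) with hg
  -- pointwise
  have hP'le : ∀ τ : ℝ, 0 < τ → ‖P c' τ‖ ≤ α * besselI 0 (τ / d) := fun τ hτ =>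
    norm_row_sum_range_le (by positivity) m J c'
  have hPdiff : ∀ τ : ℝ, P c τ - P c' τ = P (fun j => c j - c' j) τ := by
    intro τ
    simp only [hP, ← Finset.sum_sub_distrib]
    refine Finset.sum_congr rfl fun j _ => by ring
  have hPdle : ∀ τ : ℝ, 0 < τ → ‖P c τ - P c' τ‖ ≤ η * besselI 0 (τ / d) := fun τ hτ => by
    rw [hPdiff]; exact norm_row_sum_range_le (by positivity) m J _
  have hPle : ∀ τ : ℝ, 0 < τ → ‖P c τ‖ ≤ (α + η) * besselI 0 (τ / d) := fun τ hτ => by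
    calc ‖P c τ‖ = ‖P c' τ + (P c τ - P c' τ)‖ := by rw [add_sub_cancel]
      _ ≤ ‖P c' τ‖ + ‖P c τ - P c' τ‖ := norm_add_le _ _
      _ ≤ α * besselI 0 (τ / d) + η * besselI 0 (τ / d) := add_le_add (hP'le τ hτ) (hPdle τ hτ)
      _ = (α + η) * besselI 0 (τ / d) := by ring
  have hq : ∀ τ : ℝ, Real.exp (-τ) * besselI 0 (τ / d) ^ d = ∏ μ : Fin d, srwHeatKernel (τ / d) 0 := by
    intro τ
    have e3 := exp_neg_mul_besselI_pow_mul_pow_eq_prod_srwHeatKernel hd1 (Nat.zero_le d) 0 τ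
    simp only [pow_zero, one_mul, Nat.sub_zero, Nat.not_lt_zero, if_false] at e3
    exact e3
  have hptw : ∀ τ : ℝ, 0 < τ → ‖g c τ - g c' τ‖
      ≤ ((α + η) ^ d - α ^ d) * (τ ^ n * ∏ μ : Fin d, srwHeatKernel (τ / d) 0) := by
    intro τ hτ
    have hv : 0 ≤ τ / d := by positivity
    have hI0 : 0 ≤ besselI 0 (τ / d) := besselI_nonneg hv 0
    have h1 := abs_re_add_pow_sub_re_pow_le_of_norm_le (P c' τ) (P c τ - P c' τ) (hPdle τ hτ) d
    rw [add_sub_cancel] at h1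
    have h2 : (‖P c' τ‖ + η * besselI 0 (τ / d)) ^ d - ‖P c' τ‖ ^ d
        ≤ (α * besselI 0 (τ / d) + η * besselI 0 (τ / d)) ^ d - (α * besselI 0 (τ / d)) ^ d :=
      add_pow_sub_pow_mono (norm_nonneg _) (hP'le τ hτ) (by positivity) d
    have e1 : g c τ - g c' τ = τ ^ n * Real.exp (-τ) * (((P c τ) ^ d).re - ((P c' τ) ^ d).re) := by
      simp only [hg]; ring
    rw [e1, Real.norm_eq_abs, abs_mul, abs_of_nonneg (by positivity : (0:ℝ) ≤ τ ^ n * Real.exp (-τ)),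
      ← hq τ]
    calc τ ^ n * Real.exp (-τ) * |((P c τ) ^ d).re - ((P c' τ) ^ d).re|
        ≤ τ ^ n * Real.exp (-τ) * ((α * besselI 0 (τ / d) + η * besselI 0 (τ / d)) ^ d
            - (α * besselI 0 (τ / d)) ^ d) := by
          gcongr
          exact h1.trans h2
      _ = ((α + η) ^ d - α ^ d) * (τ ^ n * (Real.exp (-τ) * besselI 0 (τ / d) ^ d)) := by
          rw [← add_mul, mul_pow, mul_pow]; ring
  -- integrability
  have hcontI : ∀ a : ℤ, Continuous fun τ : ℝ => besselI a (τ / d) := by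
    intro a
    have e : (fun τ : ℝ => besselI a (τ / d))
        = fun τ => Real.exp (τ / d) * srwHeatKernel (τ / d) a := by
      ext τ
      rw [srwHeatKernel_eq_exp_neg_mul_besselI, ← mul_assoc, ← Real.exp_add, add_neg_cancel,
        Real.exp_zero, one_mul]
    rw [e]
    exact ((Real.continuous_exp.comp (continuous_id.div_const _))).mul
      ((continuous_srwHeatKernel_left a).comp (continuous_id.div_const _))
  have hgcont : ∀ b : ℕ → ℂ, Continuous (g b) := by
    intro b
    have hPc : Continuous (P b) := by
      simp only [hP]
      refine continuous_finsetSum _ fun j _ => continuous_const.mul ((?_ : Continuous _).mul continuous_const)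
      exact Complex.continuous_ofReal.comp (hcontI _)
    simp only [hg]
    exact (continuous_pow n).mul ((Real.continuous_exp.comp continuous_neg).mul
      (Complex.continuous_re.comp (hPc.pow d)))
  have hI0int := integrableOn_pow_mul_srwHeatKernel_zero_pow n hd3
  have hdom : ∀ (C : ℝ) (b : ℕ → ℂ), 0 ≤ C → (∀ τ : ℝ, 0 < τ → ‖P b τ‖ ≤ C * besselI 0 (τ / d)) →
      ∀ τ : ℝ, 0 < τ → ‖g b τ‖ ≤ C ^ d * (τ ^ n * srwHeatKernel (τ / d) 0 ^ d) := by
    intro C b hC hb τ hτ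
    have hv : 0 ≤ τ / d := by positivity
    have hq' : Real.exp (-τ) * besselI 0 (τ / d) ^ d = srwHeatKernel (τ / d) 0 ^ d := by
      rw [hq τ, Fin.prod_const]
    have hre : |((P b τ) ^ d).re| ≤ (C * besselI 0 (τ / d)) ^ d := by
      calc |((P b τ) ^ d).re| ≤ ‖(P b τ) ^ d‖ := Complex.abs_re_le_norm _
        _ = ‖P b τ‖ ^ d := norm_pow _ _
        _ ≤ (C * besselI 0 (τ / d)) ^ d := pow_le_pow_left₀ (norm_nonneg _) (hb τ hτ) d
    simp only [hg]
    rw [norm_mul, norm_mul, Real.norm_eq_abs, Real.norm_eq_abs, Real.norm_eq_abs,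
      abs_of_nonneg (pow_nonneg hτ.le n), abs_of_pos (Real.exp_pos _)]
    calc τ ^ n * (Real.exp (-τ) * |((P b τ) ^ d).re|)
        ≤ τ ^ n * (Real.exp (-τ) * (C * besselI 0 (τ / d)) ^ d) := by gcongr
      _ = C ^ d * (τ ^ n * (Real.exp (-τ) * besselI 0 (τ / d) ^ d)) := by rw [mul_pow]; ring
      _ = C ^ d * (τ ^ n * srwHeatKernel (τ / d) 0 ^ d) := by rw [hq']
  have hgint : ∀ (C : ℝ) (b : ℕ → ℂ), 0 ≤ C → (∀ τ : ℝ, 0 < τ → ‖P b τ‖ ≤ C * besselI 0 (τ / d)) →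
      Integrable (g b) (volume.restrict (Ioi 0)) := by
    intro C b hC hb
    refine Integrable.mono' ((hI0int.const_mul (C ^ d))) (hgcont b).aestronglyMeasurable ?_
    rw [ae_restrict_iff' measurableSet_Ioi]
    exact Eventually.of_forall fun τ hτ => hdom C b hC hb τ hτ
  have hgc := hgint (α + η) c (by positivity) hPle
  have hgc' := hgint α c' hα0 hP'le
  have hhint : Integrable (fun τ : ℝ => ((α + η) ^ d - α ^ d)
      * (τ ^ n * ∏ μ : Fin d, srwHeatKernel (τ / d) 0)) (volume.restrict (Ioi 0)) :=
    (integrableOn_pow_mul_prod_srwHeatKernel n hd3 (fun _ : Fin d => (0:ℤ))).const_mul _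
  -- assemble
  have hnorm : ‖∫ τ in Ioi (0:ℝ), (g c τ - g c' τ)‖
      ≤ ∫ τ in Ioi (0:ℝ), ((α + η) ^ d - α ^ d) * (τ ^ n * ∏ μ : Fin d, srwHeatKernel (τ / d) 0) := by
    refine norm_integral_le_of_norm_le hhint ?_
    rw [ae_restrict_iff' measurableSet_Ioi]
    exact Eventually.of_forall fun τ hτ => hptw τ hτ
  rw [integral_const_mul] at hnorm
  have hseed : ∫ τ in Ioi (0:ℝ), τ ^ n * ∏ μ : Fin d, srwHeatKernel (τ / d) 0
      = (n ! : ℝ) * srwI d (n + 1) 0 (fun _ : Fin d => 0) := by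
    rw [srwI_succ_zero_eq_integral_prod_srwHeatKernel_div n hd3 (fun _ : Fin d => (0:ℤ))]
    field_simp
  rw [hseed] at hnorm
  have hdiff : (n ! : ℝ)⁻¹ * (∫ τ in Ioi (0:ℝ), g c τ) / (2 * π) ^ d
      - (n ! : ℝ)⁻¹ * (∫ τ in Ioi (0:ℝ), g c' τ) / (2 * π) ^ d
      = (n ! : ℝ)⁻¹ * (∫ τ in Ioi (0:ℝ), (g c τ - g c' τ)) / (2 * π) ^ d := by
    rw [integral_sub hgc hgc']
    ring
  show |(n ! : ℝ)⁻¹ * (∫ τ in Ioi (0:ℝ), g c τ) / (2 * π) ^ d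
      - (n ! : ℝ)⁻¹ * (∫ τ in Ioi (0:ℝ), g c' τ) / (2 * π) ^ d|
    ≤ ((α + η) ^ d - α ^ d) / (2 * π) ^ d * srwI d (n + 1) 0 (fun _ : Fin d => 0)
  rw [hdiff, abs_div, abs_mul, abs_of_pos (by positivity : (0:ℝ) < (n ! : ℝ)⁻¹),
    abs_of_pos (by positivity : (0:ℝ) < (2 * π) ^ d), ← Real.norm_eq_abs]
  calc (n ! : ℝ)⁻¹ * ‖∫ τ in Ioi (0:ℝ), (g c τ - g c' τ)‖ / (2 * π) ^ d
      ≤ (n ! : ℝ)⁻¹ * (((α + η) ^ d - α ^ d) * ((n ! : ℝ) * srwI d (n + 1) 0 (fun _ : Fin d => 0)))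
          / (2 * π) ^ d := by gcongr
    _ = ((α + η) ^ d - α ^ d) / (2 * π) ^ d * srwI d (n + 1) 0 (fun _ : Fin d => 0) := by
        field_simp

/-! ### Coarsening: one axis seed per `(n, J, M)` -/

/-- Two-level seeds are monotone in the number of nonzero coordinates: for `1 ≤ k` and any `c`,
`I_{n+1,0}(c(e_0+…+e_{k-1})) ≤ I_{n+1,0}(c e_0)` (`q_v(c) ≤ q_v(0)` coordinatewise in the Bessel
`u`-representation). [cite: FitznerVanDerHofstad2016NoBLE, §5.1.1 (5.2)–(5.4); DLMF, 10.37] -/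
theorem srwI_twoLevel_le_axis (n : ℕ) (hd : 2 * n + 3 ≤ d) {k : ℕ} (hk : 1 ≤ k) (c : ℤ) :
    srwI d (n + 1) 0 (fun μ : Fin d => if (μ : ℕ) < k then c else 0)
      ≤ srwI d (n + 1) 0 (fun μ : Fin d => if (μ : ℕ) < 1 then c else 0) := by
  have hd0 : (0:ℝ) < d := by exact_mod_cast (by omega : 0 < d)
  have hn : (0:ℝ) < (n ! : ℝ) := by positivity
  rw [srwI_succ_zero_eq_integral_prod_srwHeatKernel_div n hd,
    srwI_succ_zero_eq_integral_prod_srwHeatKernel_div n hd]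
  refine mul_le_mul_of_nonneg_left ?_ (by positivity)
  refine setIntegral_mono_on (integrableOn_pow_mul_prod_srwHeatKernel n hd _)
    (integrableOn_pow_mul_prod_srwHeatKernel n hd _) measurableSet_Ioi fun τ hτ => ?_
  have hv : 0 ≤ τ / d := by positivity [le_of_lt (show (0:ℝ) < τ from hτ)]
  refine mul_le_mul_of_nonneg_left ?_ (pow_nonneg (le_of_lt hτ) n)
  refine Finset.prod_le_prod (fun μ _ => srwHeatKernel_nonneg hv _) fun μ _ => ?_
  by_cases h1 : (μ : ℕ) < 1
  · have hk' : (μ : ℕ) < k := lt_of_lt_of_le h1 hk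
    rw [if_pos h1, if_pos hk']
  · rw [if_neg h1]
    split_ifs
    · exact srwHeatKernel_le_zero_index hv c
    · exact le_rfl

/-- **Coarsened truncation cost: ONE axis seed.** Under the hypotheses of
`abs_srwTwist_sub_rowTrunc_le_sum_srwI`,
`|srwTwist d (n+1) 1 (m e_i) β − (truncated object)| ≤ ((A_J + 2δ_J)^d − A_J^d) · I_{n+1,0}((J+1)M e_0)`
(all two-level seeds replaced by the axis seed; binomial resummation). For the kernel this is one
extra plain certificate per `(n, J, M)`. [cite: FitznerVanDerHofstad2016NoBLE, (3.34)–(3.36) p. 1071,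
§5.1.1 (5.2)–(5.5); DLMF, 10.35.2, 10.14.4] -/
theorem abs_srwTwist_sub_rowTrunc_le_incr_mul_srwI (n : ℕ) (hd : 2 * (n + 1) + 1 ≤ d) (i : Fin d)
    {m : ℤ} (hm : m ≠ 0) (β : ℝ) (J M : ℕ) (hM : M ≤ m.natAbs) :
    |srwTwist d (n + 1) (fun _ => 1) (Pi.single i m) β
      - (n ! : ℝ)⁻¹ * (∫ τ in Ioi (0:ℝ), τ ^ n * (Real.exp (-τ) *
          ((∑ j ∈ Finset.range (J + 1), (if j = 0 then (1 : ℂ) else 2)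
            * ((besselI (j * m) (τ / d) : ℂ)
              * (2 * π * Complex.I ^ j * (besselJ j (β / d) : ℂ)))) ^ d).re))
        / (2 * π) ^ d|
    ≤ (((∑ j ∈ Finset.range (J + 1), (if j = 0 then (1 : ℝ) else 2) * |besselJ j (β / d)|)
          + 2 * ∑' l : ℕ, |besselJ (l + J + 1) (β / d)|) ^ d
        - (∑ j ∈ Finset.range (J + 1), (if j = 0 then (1 : ℝ) else 2) * |besselJ j (β / d)|) ^ d)
      * srwI d (n + 1) 0 (fun μ : Fin d => if (μ : ℕ) < 1 then ((((J + 1) * M : ℕ)) : ℤ) else 0) := by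
  have hd3 : 2 * n + 3 ≤ d := by omega
  set A : ℝ := ∑ j ∈ Finset.range (J + 1), (if j = 0 then (1 : ℝ) else 2) * |besselJ j (β / d)|
    with hA
  set δ : ℝ := ∑' l : ℕ, |besselJ (l + J + 1) (β / d)| with hδ
  set c : ℤ := ((((J + 1) * M : ℕ)) : ℤ) with hc
  have hA0 : 0 ≤ A := Finset.sum_nonneg fun j _ => by
    have : (0:ℝ) ≤ (if j = 0 then (1 : ℝ) else 2) := by split_ifs <;> norm_num
    positivity
  have hδ0 : 0 ≤ δ := tsum_nonneg fun l => abs_nonneg _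
  have h := abs_srwTwist_sub_rowTrunc_le_sum_srwI n hd i hm β J M hM
  refine h.trans ?_
  rw [add_pow_sub_pow_eq_sum A (2 * δ) d, Finset.sum_mul]
  refine Finset.sum_le_sum fun k hk => ?_
  have hmono := srwI_twoLevel_le_axis (d := d) n hd3 (k := k + 1) (by omega) c
  have hcoef : 0 ≤ (d.choose (k + 1) : ℝ) * A ^ (d - (k + 1)) * (2 * δ) ^ (k + 1) := by positivity
  exact mul_le_mul_of_nonneg_left hmono hcoef

/-- Coarsened unit-anchored form: `|srwTwist d (n+1) 1 (m e_i) β − S_J| ≤ ((1 + 2δ_J)^d − 1) ·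
srwI d (n+1) 0 ((J+1)M e_0)` — ONE plain axis seed per `(n, J, M)`, no `A_J`.
[cite: FitznerVanDerHofstad2016NoBLE, (3.34)–(3.36) p. 1071, §5.1.1 (5.2)–(5.5); DLMF, 10.35.2, 10.14.4] -/
theorem abs_srwTwist_sub_rowTrunc_le_incr_mul_srwI_unit (n : ℕ) (hd : 2 * (n + 1) + 1 ≤ d)
    (i : Fin d) {m : ℤ} (hm : m ≠ 0) (β : ℝ) (J M : ℕ) (hM : M ≤ m.natAbs) :
    |srwTwist d (n + 1) (fun _ => 1) (Pi.single i m) β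
      - (n ! : ℝ)⁻¹ * (∫ τ in Ioi (0:ℝ), τ ^ n * (Real.exp (-τ) *
          ((∑ j ∈ Finset.range (J + 1), (if j = 0 then (1 : ℂ) else 2)
            * ((besselI (j * m) (τ / d) : ℂ)
              * (2 * π * Complex.I ^ j * (besselJ j (β / d) : ℂ)))) ^ d).re))
        / (2 * π) ^ d|
    ≤ ((1 + 2 * ∑' l : ℕ, |besselJ (l + J + 1) (β / d)|) ^ d - 1)
      * srwI d (n + 1) 0 (fun μ : Fin d => if (μ : ℕ) < 1 then ((((J + 1) * M : ℕ)) : ℤ) else 0) := by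
  have hd3 : 2 * n + 3 ≤ d := by omega
  set δ : ℝ := ∑' l : ℕ, |besselJ (l + J + 1) (β / d)| with hδ
  set c : ℤ := ((((J + 1) * M : ℕ)) : ℤ) with hc
  have hδ0 : 0 ≤ δ := tsum_nonneg fun l => abs_nonneg _
  have h := abs_srwTwist_sub_rowTrunc_le_sum_srwI_unit n hd i hm β J M hM
  refine h.trans ?_
  have e : (1 + 2 * δ) ^ d - 1 = (1 + 2 * δ) ^ d - 1 ^ d := by rw [one_pow]
  rw [e, add_pow_sub_pow_eq_sum 1 (2 * δ) d, Finset.sum_mul]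
  refine Finset.sum_le_sum fun k hk => ?_
  rw [one_pow, mul_one]
  have hmono := srwI_twoLevel_le_axis (d := d) n hd3 (k := k + 1) (by omega) c
  have hcoef : 0 ≤ (d.choose (k + 1) : ℝ) * (2 * δ) ^ (k + 1) := by positivity
  exact mul_le_mul_of_nonneg_left hmono hcoef

/-- **What a twisted-seed kernel certificate discharges** (unit form + coefficient perturbation
combined): for ANY finite coefficient vector `c' : ℕ → ℂ` (in a kernel: `c'_j = 2π iʲ q_j`, `q_j ∈ ℚ`),
`|srwTwist d (n+1) 1 (m e_i) β − S(c')| ≤ Σ_{k<d} C(d,k+1)(2δ_J)^{k+1}·srwI d (n+1) 0 x_{k+1}`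
`+ ((α'+η)^d − α'^d)/(2π)^d · srwI d (n+1) 0 0`, with `α' = Σ_{j≤J} ε_j‖c'_j‖` and
`η = Σ_{j≤J} ε_j‖2π iʲ J_j(β/d) − c'_j‖`: the kernel certifies the exact-row object `S(c')` and plain
seeds; everything else is this inequality. [cite: FitznerVanDerHofstad2016NoBLE, (3.34)–(3.36) p. 1071,
§5.1.1 (5.2)–(5.5); DLMF, 10.35.2, 10.14.4, 10.37] -/
theorem abs_srwTwist_sub_rowObj_le (n : ℕ) (hd : 2 * (n + 1) + 1 ≤ d) (i : Fin d)
    {m : ℤ} (hm : m ≠ 0) (β : ℝ) (J M : ℕ) (hM : M ≤ m.natAbs) (c' : ℕ → ℂ) :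
    |srwTwist d (n + 1) (fun _ => 1) (Pi.single i m) β
      - (n ! : ℝ)⁻¹ * (∫ τ in Ioi (0:ℝ), τ ^ n * (Real.exp (-τ) *
          ((∑ j ∈ Finset.range (J + 1), (if j = 0 then (1 : ℂ) else 2)
            * ((besselI (j * m) (τ / d) : ℂ) * c' j)) ^ d).re)) / (2 * π) ^ d|
    ≤ (∑ k ∈ Finset.range d, (d.choose (k + 1) : ℝ)
        * (2 * ∑' l : ℕ, |besselJ (l + J + 1) (β / d)|) ^ (k + 1)
        * srwI d (n + 1) 0
            (fun μ : Fin d => if (μ : ℕ) < k + 1 then ((((J + 1) * M : ℕ)) : ℤ) else 0))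
      + (((∑ j ∈ Finset.range (J + 1), (if j = 0 then (1 : ℝ) else 2) * ‖c' j‖)
          + ∑ j ∈ Finset.range (J + 1), (if j = 0 then (1 : ℝ) else 2)
              * ‖2 * π * Complex.I ^ j * (besselJ j (β / d) : ℂ) - c' j‖) ^ d
        - (∑ j ∈ Finset.range (J + 1), (if j = 0 then (1 : ℝ) else 2) * ‖c' j‖) ^ d) / (2 * π) ^ d
      * srwI d (n + 1) 0 (fun _ : Fin d => 0) := by
  have h1 := abs_srwTwist_sub_rowTrunc_le_sum_srwI_unit n hd i hm β J M hM
  have h2 := abs_rowObj_sub_rowObj_le_incr_mul_srwI_zero (d := d) n hd m J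
    (fun j => 2 * π * Complex.I ^ j * (besselJ j (β / d) : ℂ)) c'
  exact (abs_sub_le _ _ _).trans (add_le_add h1 h2)

/-- **The m-uniform row device in closed form** (`J = 0`): for `d ≥ 2n+3`, every `β`, every
`M : ℕ` and EVERY `m` with `|m| ≥ M`, `m ≠ 0`,
`|srwTwist d (n+1) 1 (m e_i) β − J_0(β/d)^d · srwI d (n+1) 0 0|`
`≤ Σ_{k<d} C(d,k+1) |J_0(β/d)|^{d-(k+1)} (2δ_0(β/d))^{k+1} · srwI d (n+1) 0 (M(e_0+…+e_k))`,
`δ_0(y) = Σ_{l≥0} |J_{l+1}(y)|` — the main term is `J_0(β/d)^d` times the origin seed and the error is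
plain seeds at the points with `k+1` coordinates `M`; the right-hand side does not depend on `m`.
[cite: FitznerVanDerHofstad2016NoBLE, (3.34)–(3.36) p. 1071, §5.1.1 (5.2)–(5.5); DLMF, 10.35.2, 10.14.4] -/
theorem abs_srwTwist_sub_besselJ_zero_pow_mul_srwI_le (n : ℕ) (hd : 2 * (n + 1) + 1 ≤ d) (i : Fin d)
    {m : ℤ} (hm : m ≠ 0) (β : ℝ) (M : ℕ) (hM : M ≤ m.natAbs) :
    |srwTwist d (n + 1) (fun _ => 1) (Pi.single i m) β
      - besselJ 0 (β / d) ^ d * srwI d (n + 1) 0 (fun _ => 0)|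
    ≤ ∑ k ∈ Finset.range d, (d.choose (k + 1) : ℝ) * |besselJ 0 (β / d)| ^ (d - (k + 1))
        * (2 * ∑' l : ℕ, |besselJ (l + 1) (β / d)|) ^ (k + 1)
        * srwI d (n + 1) 0 (fun μ : Fin d => if (μ : ℕ) < k + 1 then (M : ℤ) else 0) := by
  have hd1 : 1 ≤ d := by omega
  have hd3 : 2 * n + 3 ≤ d := by omega
  have hn0 : (n ! : ℝ) ≠ 0 := by positivity
  have hπ : (0 : ℝ) < π := Real.pi_pos
  have h := abs_srwTwist_sub_rowTrunc_le_sum_srwI n hd i hm β 0 M hM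
  simp only [zero_add, Finset.range_one, Finset.sum_singleton, if_true, one_mul,
    pow_zero, Nat.cast_zero, zero_mul, add_zero, mul_one] at h
  -- identify the truncated object: `P_0(τ/d) = 2π J_0(y) I_0(τ/d)`, so the integral is the origin seed
  have hS : (n ! : ℝ)⁻¹ * (∫ τ in Ioi (0:ℝ), τ ^ n * (Real.exp (-τ) *
        (((besselI 0 (τ / d) : ℂ) * (2 * π * (besselJ 0 (β / d) : ℂ))) ^ d).re)) / (2 * π) ^ d
      = besselJ 0 (β / d) ^ d * srwI d (n + 1) 0 (fun _ => 0) := by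
    have e1 : ∀ τ : ℝ, τ ^ n * (Real.exp (-τ) *
        (((besselI 0 (τ / d) : ℂ) * (2 * π * (besselJ 0 (β / d) : ℂ))) ^ d).re)
        = (2 * π * besselJ 0 (β / d)) ^ d * (τ ^ n * ∏ μ : Fin d, srwHeatKernel (τ / d) 0) := by
      intro τ
      have e2 : (((besselI 0 (τ / d) : ℂ) * (2 * π * (besselJ 0 (β / d) : ℂ))) ^ d).re
          = (besselI 0 (τ / d) * (2 * π * besselJ 0 (β / d))) ^ d := by
        have : ((besselI 0 (τ / d) : ℂ) * (2 * π * (besselJ 0 (β / d) : ℂ))) ^ d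
            = ((((besselI 0 (τ / d)) * (2 * π * besselJ 0 (β / d))) ^ d : ℝ) : ℂ) := by
          push_cast; ring
        rw [this, Complex.ofReal_re]
      have e3 := exp_neg_mul_besselI_pow_mul_pow_eq_prod_srwHeatKernel hd1 (Nat.zero_le d) 0 τ
      simp only [pow_zero, one_mul, Nat.sub_zero, Nat.not_lt_zero, if_false] at e3
      rw [e2, mul_pow, ← e3]
      ring
    simp_rw [e1]
    rw [integral_const_mul, srwI_succ_zero_eq_integral_prod_srwHeatKernel_div n hd3 (fun _ => 0),
      mul_pow]
    field_simp
  rw [hS] at h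
  exact h

end Literature.Probability.FitznerVanDerHofstad2017

end
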